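import Summits.CriticalPhenomena.SAWScalingLimit.Theorems.SAWSpinMonotoneQCIdentificationGaussBonnetExact
import Summits.CriticalPhenomena.SAWScalingLimit.Theorems.SAWSpinMonotoneQCIdentificationFacePotential

/-!
# Smirnov's primitive `Ξ = F^{8/5} dz`, I: the branch-consistent lift of `arg ∂H` on the source
component (helper sub-goal (B′) of `stub_rayCondition`, line `eight_fifths_primitive`, crux
`QCIdentification`, stmt-CriticalPhenomena-16772)

**Setting.** `Λ` a simply connected hexagonal domain, boundary source `a = {u_a, v_a}` (`v_a ∈ Λ`,
`u_a ∉ Λ`, adjacent), `F = Fobs Λ a` the critical parafermionic observable, `S_v = modeSum F v` the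
`∂H`-mode of the face `v`, `Λ₀ = NB.srcComp Λ v_a` the source component (the faces of `Λ` joined to
`v_a` inside `Λ`), on which `S_v ≠ 0` under the no-fold bound (K) (`NoFoldBound`,
`NB.modeSum_ne_zero_of_mem_srcComp`).

**What.**

* `xi_srcComp_simplyConnected` (registered): the source component of a simply connected domain is
  simply connected (its complement `Λᶜ ∪ (Λ ∖ Λ₀)` is connected in `ℍ`: from a face of `Λ ∖ Λ₀` climb
  to the topmost face of `Λ` reachable inside `Λ₀ᶜ` — its upper neighbour is outside `Λ` — and `Λᶜ`
  itself is connected);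
* `xi_arg_modeSum_div_antisymm` (registered): for adjacent faces `v, w ∈ Λ` with non-zero modes the
  ratio `S_w / S_v` is a quotient of two numbers of the open right half-plane (the corner factors of
  `…NoBranchingHexagonAux`, `NB.modeSum_succ_div`), so `|arg (S_w/S_v)| < π` and
  `arg (S_v/S_w) = -arg (S_w/S_v)`: the increments `d v w = arg (S_w/S_v)` are ANTISYMMETRIC; they
  are CLOSED around every complete hexagon of `Λ₀` by `NoBranching` (`NB.noBranching_of_noFoldBound`);
* `xi_exists_argLift` (registered): hence (dual discrete Poincaré lemma
  `FacePot.fp_exists_facePotential` on `Λ₀`) there is a **lifted argument** `Θ : HexVertex → ℝ` with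
  `Θ w - Θ v = arg (S_w / S_v)` for all adjacent `v, w ∈ Λ₀`, `Θ v ≡ arg S_v (mod 2π)` for every
  `v ∈ Λ₀` (induction along a path from `v_a`: `arg (S_w/S_v) ≡ arg S_w - arg S_v`), normalised by
  `Θ v_a = arg S_{v_a}`.

With `Θ` the local constants `L_v = (‖S_v‖/3)^{8/5} e^{i(8/5)Θ_v}` make the principal `8/5`-th
powers of the port values single-valued across shared mid-edges (sibling file `…XiForm`).
Conventions validated by exact enumeration (`work/stubs/scratch_xi/xi_check.py`: 83 instances,
closure residual ≤ 5e-16).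

Sources: S. Smirnov, *Towards conformal invariance of 2D lattice models*, Proc. ICM 2006
(arXiv:0708.0032) §5.6; H. Duminil-Copin, S. Smirnov, Ann. of Math. 175 (2012) 1653–1665
(arXiv:1007.0575), Lemma 1; the stub report `STUB-REPORT-rayCondition.md` ((B)) of this line.
-/

noncomputable section

open Complex
open Literature.Probability.LatticeModels Literature.Probability.RandomPlanarGeometry
open Literature.Probability.RandomPlanarGeometry.SAW
open Literature.Barriers.CriticalPhenomena Literature.Barriers.CriticalPhenomena.HexKernel
open Summit.CriticalPhenomena.SAWScalingLimit.Theses.SAWDevelopingMap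

namespace Summit.CriticalPhenomena.SAWScalingLimit.Cruxes.QCIdentification.EightFifthsPrimitive

namespace Xi

open NB

variable {Λ : Finset HexVertex} {ua va : HexVertex}

/-! ### The source component is simply connected -/

/-- Every face has a neighbour strictly above it (for the height `2·x₁ + type`). -/
theorem exists_higher_hexNbr (v : HexVertex) :
    ∃ k : Fin 3, 2 * v.1 1 + ((v.2 : ℕ) : ℤ) < 2 * (hexNbr v k).1 1 + (((hexNbr v k).2 : ℕ) : ℤ) := by
  obtain ⟨x, t⟩ := v
  fin_cases t
  · exact ⟨0, by simp [hexNbr]⟩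
  · refine ⟨2, ?_⟩
    simp [hexNbr]
    omega

/-- **Climbing out of the source component.** From a face outside the source component `Λ₀` one
reaches, through faces outside `Λ₀`, a face outside `Λ`: climb to the topmost face of `Λ` reachable
inside `Λ₀ᶜ`; its upper neighbour is outside `Λ₀` (the source component is closed under
`Λ`-adjacency) and not in `Λ` (it is higher). -/
theorem exists_reachable_not_mem {w : HexVertex} (hw0 : w ∉ srcComp Λ va) :
    ∃ (u : HexVertex) (hu : u ∉ srcComp Λ va), u ∉ Λ ∧
      (hexGraph.induce ((↑(srcComp Λ va) : Set HexVertex)ᶜ)).Reachable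
        ⟨w, by simpa using hw0⟩ ⟨u, by simpa using hu⟩ := by
  classical
  by_cases hwΛ : w ∈ Λ
  swap
  · exact ⟨w, hw0, hwΛ, SimpleGraph.Reachable.refl _⟩
  set T : Finset HexVertex := Λ.filter fun u => ∃ hu : u ∉ srcComp Λ va,
    (hexGraph.induce ((↑(srcComp Λ va) : Set HexVertex)ᶜ)).Reachable
      ⟨w, by simpa using hw0⟩ ⟨u, by simpa using hu⟩ with hT
  have hwT : w ∈ T := Finset.mem_filter.2 ⟨hwΛ, hw0, SimpleGraph.Reachable.refl _⟩
  obtain ⟨u, huT, hmax⟩ :=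
    Finset.exists_max_image T (fun f : HexVertex => 2 * f.1 1 + ((f.2 : ℕ) : ℤ)) ⟨w, hwT⟩
  obtain ⟨huΛ, hu0, hr⟩ := Finset.mem_filter.1 huT
  obtain ⟨k, hk⟩ := exists_higher_hexNbr u
  have hu'0 : hexNbr u k ∉ srcComp Λ va :=
    fun h => hu0 (mem_srcComp_of_adj h huΛ (adj_hexNbr u k).symm)
  have hr' : (hexGraph.induce ((↑(srcComp Λ va) : Set HexVertex)ᶜ)).Reachable
      ⟨w, by simpa using hw0⟩ ⟨hexNbr u k, by simpa using hu'0⟩ :=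
    hr.trans (SimpleGraph.Adj.reachable (SimpleGraph.induce_adj.2 (adj_hexNbr u k)))
  by_cases hu'Λ : hexNbr u k ∈ Λ
  · have h := hmax (hexNbr u k) (Finset.mem_filter.2 ⟨hu'Λ, hu'0, hr'⟩)
    omega
  · exact ⟨hexNbr u k, hu'0, hu'Λ, hr'⟩

/-- **The source component of a simply connected domain is simply connected (registered).** The
complement of `Λ₀ = NB.srcComp Λ va` is connected in `ℍ`: every face of `Λ₀ᶜ` is joined inside `Λ₀ᶜ`
to a face of `Λᶜ ⊆ Λ₀ᶜ` (`exists_reachable_not_mem`), and `Λᶜ` is connected. -/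
theorem xi_srcComp_simplyConnected : ∀ {Λ : Finset HexVertex}, hexDomainSimplyConnected Λ → ∀ (va : HexVertex), hexDomainSimplyConnected (NB.srcComp Λ va) := by
  intro Λ hΛ va p q
  have hp : p.1 ∉ srcComp Λ va := fun h => p.2 (Finset.mem_coe.2 h)
  have hq : q.1 ∉ srcComp Λ va := fun h => q.2 (Finset.mem_coe.2 h)
  obtain ⟨p₁, hp₁0, hp₁Λ, hrp⟩ := exists_reachable_not_mem (Λ := Λ) (va := va) (w := p.1) hp
  obtain ⟨q₁, hq₁0, hq₁Λ, hrq⟩ := exists_reachable_not_mem (Λ := Λ) (va := va) (w := q.1) hq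
  have hsub : ((↑Λ : Set HexVertex)ᶜ) ⊆ ((↑(srcComp Λ va) : Set HexVertex)ᶜ) :=
    Set.compl_subset_compl.2 (fun x hx => Finset.mem_coe.2 (srcComp_subset (Finset.mem_coe.1 hx)))
  have h := (hΛ ⟨p₁, by simpa using hp₁Λ⟩ ⟨q₁, by simpa using hq₁Λ⟩).map
    (SimpleGraph.induceHomOfLE hexGraph hsub).toHom
  exact hrp.trans (h.trans hrq.symm)

/-! ### The increments `arg (S_w / S_v)` are antisymmetric -/

/-- **The mode ratio of adjacent faces is a right half-plane quotient.** For `v, hexNbr v k ∈ Λ`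
with non-zero `∂H`-modes, `arg (S_{hexNbr v k} / S_v) = arg Q - arg P` for two numbers `P`, `Q` of
positive real part (the corner factors at the site `triVert v (k+1)` shared by the two faces,
`NB.modeSum_succ_div`). -/
theorem exists_arg_modeSum_div_eq (hK : NoFoldBound) (hΛ : hexDomainSimplyConnected Λ)
    {a : Sym2 HexVertex} (ha : a ∈ hexDomainBoundary Λ) {v : HexVertex} (k : Fin 3) (hv : v ∈ Λ)
    (hw : hexNbr v k ∈ Λ) (hSv : modeSum (Fobs Λ a) v ≠ 0)
    (hSw : modeSum (Fobs Λ a) (hexNbr v k) ≠ 0) :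
    ∃ P Q : ℂ, 0 < P.re ∧ 0 < Q.re ∧
      arg (modeSum (Fobs Λ a) (hexNbr v k) / modeSum (Fobs Λ a) v) = arg Q - arg P := by
  obtain ⟨l, hl, hlk⟩ := s4_exists_face_eq_of_corner v k
  set s := Dev.triVert v (k + 1) with hs
  have hw' : hexNbr v k = face s (l + 1) := by
    rw [← hl, ← hlk]
    exact hexNbr_face_arcCornerIdx s l
  have hv1 : face s l ∈ Λ := hl ▸ hv
  have hS1 : modeSum (Fobs Λ a) (face s l) ≠ 0 := hl ▸ hSv
  have hv2 : face s (l + 1) ∈ Λ := hw' ▸ hw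
  have hS2 : modeSum (Fobs Λ a) (face s (l + 1)) ≠ 0 := hw' ▸ hSw
  refine ⟨pfac (Fobs Λ a) s (l + 1), qfac (Fobs Λ a) s l, pfac_re_pos hK hΛ ha hv2 hS2,
    qfac_re_pos hK hΛ ha hv1 hS1, ?_⟩
  rw [hw']
  conv_lhs => rw [← hl]
  rw [modeSum_succ_div hK hΛ ha l hv1 hv2 hS1 hS2,
    arg_div_of_re_pos (qfac_re_pos hK hΛ ha hv1 hS1) (pfac_re_pos hK hΛ ha hv2 hS2)]

/-- **No adjacent faces with opposite modes**: `|arg (S_{hexNbr v k} / S_v)| < π`. -/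
theorem abs_arg_modeSum_div_lt_pi (hK : NoFoldBound) (hΛ : hexDomainSimplyConnected Λ)
    {a : Sym2 HexVertex} (ha : a ∈ hexDomainBoundary Λ) {v : HexVertex} (k : Fin 3) (hv : v ∈ Λ)
    (hw : hexNbr v k ∈ Λ) (hSv : modeSum (Fobs Λ a) v ≠ 0)
    (hSw : modeSum (Fobs Λ a) (hexNbr v k) ≠ 0) :
    |arg (modeSum (Fobs Λ a) (hexNbr v k) / modeSum (Fobs Λ a) v)| < Real.pi := by
  obtain ⟨P, Q, hP, hQ, h⟩ := exists_arg_modeSum_div_eq hK hΛ ha k hv hw hSv hSw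
  have hPa := abs_lt.1 (Complex.abs_arg_lt_pi_div_two_iff.2 (Or.inl hP))
  have hQa := abs_lt.1 (Complex.abs_arg_lt_pi_div_two_iff.2 (Or.inl hQ))
  rw [h, abs_lt]
  constructor <;> linarith

/-- **Antisymmetry of the increments (registered).** Under `NoFoldBound`, for adjacent faces
`v, w` of a simply connected domain with boundary source and non-zero `∂H`-modes,
`arg (S_v / S_w) = -arg (S_w / S_v)` (the ratio is never a negative real). -/
theorem xi_arg_modeSum_div_antisymm : NoFoldBound → ∀ {Λ : Finset HexVertex}, hexDomainSimplyConnected Λ → ∀ {a : Sym2 HexVertex}, a ∈ hexDomainBoundary Λ → ∀ {v w : HexVertex}, v ∈ Λ → w ∈ Λ → hexGraph.Adj v w → modeSum (Fobs Λ a) v ≠ 0 → modeSum (Fobs Λ a) w ≠ 0 → Complex.arg (modeSum (Fobs Λ a) v / modeSum (Fobs Λ a) w) = -Complex.arg (modeSum (Fobs Λ a) w / modeSum (Fobs Λ a) v) := by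
  intro hK Λ hΛ a ha v w hv hw hadj hSv hSw
  obtain ⟨k, rfl⟩ := exists_hexNbr_eq hadj
  have hlt := abs_arg_modeSum_div_lt_pi hK hΛ ha k hv hw hSv hSw
  have hne : arg (modeSum (Fobs Λ a) (hexNbr v k) / modeSum (Fobs Λ a) v) ≠ Real.pi := by
    intro h
    rw [h, abs_of_pos Real.pi_pos] at hlt
    exact lt_irrefl _ hlt
  rw [← inv_div, Complex.arg_inv, if_neg hne]

/-! ### The lifted argument -/

/-- **A face potential for `arg (S_w / S_v)` on the source component** (dual discrete Poincaré
lemma `FacePot.fp_exists_facePotential` on the simply connected `Λ₀`, the increments being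
antisymmetric and closed around complete hexagons by `NoBranching`). -/
theorem exists_facePotential_arg (hK : NoFoldBound) (hΛ : hexDomainSimplyConnected Λ)
    (hva : va ∈ Λ) (hua : ua ∉ Λ) (hadj : hexGraph.Adj va ua) :
    ∃ θ : HexVertex → ℝ, ∀ v ∈ srcComp Λ va, ∀ w ∈ srcComp Λ va, hexGraph.Adj v w →
      θ w - θ v = arg (modeSum (Fobs Λ s(ua, va)) w / modeSum (Fobs Λ s(ua, va)) v) := by
  have ha : s(ua, va) ∈ hexDomainBoundary Λ := mk_mem_boundary hva hua hadj
  refine FacePot.fp_exists_facePotential (srcComp Λ va) (xi_srcComp_simplyConnected hΛ va)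
    (fun v w => arg (modeSum (Fobs Λ s(ua, va)) w / modeSum (Fobs Λ s(ua, va)) v))
    (fun v hv w hw hvw => ?_) (fun s hs => ?_)
  · exact xi_arg_modeSum_div_antisymm hK hΛ ha (srcComp_subset hv) (srcComp_subset hw) hvw
      (modeSum_ne_zero_of_mem_srcComp hK hΛ hua hadj hv)
      (modeSum_ne_zero_of_mem_srcComp hK hΛ hua hadj hw)
  · exact noBranching_of_noFoldBound hK Λ hΛ _ ha s (fun j => srcComp_subset (hs j))
      (fun j => modeSum_ne_zero_of_mem_srcComp hK hΛ hua hadj (hs j))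

/-- **Propagation of the phase along a path.** If `θ` has the increments `arg (S_w/S_v)` across
adjacent faces of the source component, then along every path of `Λ` ending at `va` the normalised
value `θ x - θ va + arg S_{va}` is a real lift of `arg S_x`. -/
theorem coe_lift_eq_arg_of_walk (hK : NoFoldBound) (hΛ : hexDomainSimplyConnected Λ)
    (hva : va ∈ Λ) (hua : ua ∉ Λ) (hadj : hexGraph.Adj va ua) {θ : HexVertex → ℝ}
    (hθ : ∀ v ∈ srcComp Λ va, ∀ w ∈ srcComp Λ va, hexGraph.Adj v w →
      θ w - θ v = arg (modeSum (Fobs Λ s(ua, va)) w / modeSum (Fobs Λ s(ua, va)) v)) :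
    ∀ (x y : (↑Λ : Set HexVertex)) (p : (hexGraph.induce (↑Λ : Set HexVertex)).Walk x y),
      y = ⟨va, by simpa using hva⟩ →
      ((θ x.1 - θ va + arg (modeSum (Fobs Λ s(ua, va)) va) : ℝ) : Real.Angle) =
        arg (modeSum (Fobs Λ s(ua, va)) x.1) := by
  intro x y p
  induction p with
  | nil =>
    rintro rfl
    simp
  | @cons u v w huv p ih =>
    rintro rfl
    have hv' := ih rfl
    have hvΛ : v.1 ∈ Λ := Finset.mem_coe.1 v.2
    have huΛ : u.1 ∈ Λ := Finset.mem_coe.1 u.2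
    have hadj' : hexGraph.Adj u.1 v.1 := SimpleGraph.induce_adj.1 huv
    have hv0 : v.1 ∈ srcComp Λ va := by
      refine mem_srcComp_iff.2 ⟨hva, hvΛ, ?_⟩
      have hr : (hexGraph.induce (↑Λ : Set HexVertex)).Reachable ⟨va, by simp [hva]⟩ v :=
        ⟨p.reverse⟩
      exact hr
    have hu0 : u.1 ∈ srcComp Λ va := mem_srcComp_of_adj hv0 huΛ hadj'.symm
    have hSu := modeSum_ne_zero_of_mem_srcComp hK hΛ hua hadj hu0
    have hSv := modeSum_ne_zero_of_mem_srcComp hK hΛ hua hadj hv0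
    have hinc := hθ v.1 hv0 u.1 hu0 hadj'.symm
    have e : θ u.1 - θ va + arg (modeSum (Fobs Λ s(ua, va)) va) =
        (θ v.1 - θ va + arg (modeSum (Fobs Λ s(ua, va)) va)) +
          arg (modeSum (Fobs Λ s(ua, va)) u.1 / modeSum (Fobs Λ s(ua, va)) v.1) := by
      rw [← hinc]; ring
    rw [e, Real.Angle.coe_add, hv', Complex.arg_div_coe_angle hSu hSv]
    abel

/-- **The lifted argument of `∂H` on the source component (registered).** Under `NoFoldBound`, for
a simply connected `Λ` with boundary source `{ua, va}` (`va ∈ Λ`, `ua ∉ Λ`, adjacent) there is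
`Θ : HexVertex → ℝ` with (i) `Θ w - Θ v = arg (S_w / S_v)` for all adjacent `v, w` of the source
component `Λ₀ = NB.srcComp Λ va` (`S = modeSum (Fobs Λ {ua, va})`), (ii) `Θ v ≡ arg S_v (mod 2π)`
for every `v ∈ Λ₀`, and (iii) `Θ va = arg S_{va}`. -/
theorem xi_exists_argLift : NoFoldBound → ∀ {Λ : Finset HexVertex}, hexDomainSimplyConnected Λ → ∀ {ua va : HexVertex}, va ∈ Λ → ua ∉ Λ → hexGraph.Adj va ua → ∃ Θ : HexVertex → ℝ, (∀ v ∈ NB.srcComp Λ va, ∀ w ∈ NB.srcComp Λ va, hexGraph.Adj v w → Θ w - Θ v = Complex.arg (modeSum (Fobs Λ s(ua, va)) w / modeSum (Fobs Λ s(ua, va)) v)) ∧ (∀ v ∈ NB.srcComp Λ va, (Θ v : Real.Angle) = Complex.arg (modeSum (Fobs Λ s(ua, va)) v)) ∧ Θ va = Complex.arg (modeSum (Fobs Λ s(ua, va)) va) := by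
  intro hK Λ hΛ ua va hva hua hadj
  obtain ⟨θ, hθ⟩ := exists_facePotential_arg hK hΛ hva hua hadj
  refine ⟨fun v => θ v - θ va + arg (modeSum (Fobs Λ s(ua, va)) va), fun v hv w hw hvw => ?_,
    fun v hv => ?_, by simp⟩
  · rw [← hθ v hv w hw hvw]
    ring
  · obtain ⟨hva', hvΛ, ⟨p⟩⟩ := mem_srcComp_iff.1 hv
    exact coe_lift_eq_arg_of_walk hK hΛ hva hua hadj hθ ⟨v, by simpa using hvΛ⟩ _ p.reverse rfl

end Xi

end Summit.CriticalPhenomena.SAWScalingLimit.Cruxes.QCIdentification.EightFifthsPrimitive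

end
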